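import Summits.CriticalPhenomena.SAWScalingLimit.Theorems.SAWLeftRightFKGFKGToTraversalBoundGermTightNecessary
import Summits.CriticalPhenomena.SAWScalingLimit.Theorems.SAWLeftRightFKGFKGToTraversalBoundShellTightOfH1
import Summits.CriticalPhenomena.SAWScalingLimit.Theorems.SAWLeftRightFKGFKGToTraversalBoundSplitWild
import Summits.CriticalPhenomena.SAWScalingLimit.Theorems.SAWLeftRightFKGFKGToTraversalBoundTameDisc
import Summits.CriticalPhenomena.SAWScalingLimit.Theorems.SAWLeftRightFKGFKGToTraversalBoundGermTightShallow
import HarnessLib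

/-!
# The germ child is necessary, and given the engine (H1) on tame domains IS germ tightness at the marked points

Crux `SAWLeftRightFKG.FKGToTraversalBound` (stmt-CriticalPhenomena-1878), line `slit-necklace`, lead c6.  Corollaries of the two
landed directions `germTight_of_eventualShellTight` (germ tightness ⟸ per-shell eventual tightness) and `eventualShellTight_of_h1At`
(per-shell eventual tightness ⟸ (H1) for the approximation; converse of `stub_eventualShellReduction`):

* `eventualShellTight_iff_h1At` — under `IsEndpointApprox`, per-shell eventual tightness and (H1) for one approximation are EQUIVALENT;
* `germTight_of_h1At`, and the registered `germTightness_of_sawTraversalBound` — the route child `GermTightness`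
  (= registered `stub_germTight`) is IMPLIED by the support item `SAWTraversalBound` (stmt-CriticalPhenomena-1880), i.e. by the
  crux's own conclusion: it is a necessary condition, consistent relative to (H1), and closes the moment any route proves (H1);
* the registered `h1At_iff_germTight_of_engine` — GIVEN the critical bubble, the engine and left–right PA, on every eventually
  TAME Dobrushin domain (H1) for an endpoint approximation holds IF AND ONLY IF the chord is germ-tight at the two marked points
  (⇐ is the landed tame necklace reduction `necklaceReduction_tame` + `stub_eventualShellReduction`; ⇒ is necessity).

So, modulo engine + bubble, the whole remaining content of the crux on tame domains is germ tightness at the two marked points —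
free on shallow approximations (`germTight_pair_of_shallow`), open on the deep fragment.  No `sorry`, no definition, no named fact.
-/

noncomputable section

open MeasureTheory Filter Topology Set Metric
open scoped NNReal ENNReal
open Literature.Probability.LatticeModels
open Literature.Probability.RandomPlanarGeometry
open Literature.Probability.RandomPlanarGeometry.SAW
open Summit.CriticalPhenomena.SAWScalingLimit.Theses.SAWLeftRightFKG
open Summit.CriticalPhenomena.SAWScalingLimit.Theses.SAWTotalPositivity (CriticalBubbleBound)
open Summit.CriticalPhenomena.SAWScalingLimit.Theorems.FKGToTraversalBound.Negative (dom H1At BdryApprox)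

namespace Summit.CriticalPhenomena.SAWScalingLimit.Theorems.FKGToTraversalBound.SlitNecklace

/-- **Per-shell eventual tightness ⟺ (H1)** for one endpoint approximation (`stub_eventualShellReduction` p127535 and its converse
`eventualShellTight_of_h1At`). [folklore] -/
theorem eventualShellTight_iff_h1At (D : DobrushinDomain) (a b : ℝ → Site 2) (hab : IsEndpointApprox D a b) :
    EventualShellTight D a b ↔ H1At D a b :=
  ⟨stub_eventualShellReduction D a b hab, eventualShellTight_of_h1At D a b⟩

/-- **(H1) for an approximation forces germ tightness at both marked points.** [folklore] -/
theorem germTight_of_h1At (D : DobrushinDomain) (a b : ℝ → Site 2) (hab : IsEndpointApprox D a b) (h : H1At D a b) :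
    GermTight D a b a ∧ GermTight D a b b :=
  germTight_of_eventualShellTight D a b hab (eventualShellTight_of_h1At D a b h)

/-- **Registered `germTightness_of_sawTraversalBound`** — the route child `GermTightness` (verbatim the registered `stub_germTight`)
follows from the support item `SAWTraversalBound` (stmt-CriticalPhenomena-1880; `Negative.traversalBound_iff_H1At` is `Iff.rfl`): germ
tightness is a NECESSARY condition for the Aizenman–Burchard hypothesis, not an extra conjecture. [folklore] -/
theorem germTightness_of_sawTraversalBound : SAWTraversalBound → ∀ (D : DobrushinDomain) (a b : ℝ → Site 2),
    IsEndpointApprox D a b → GermTight D a b a ∧ GermTight D a b b :=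
  fun h D a b hab => germTight_of_h1At D a b hab (h D a b hab)

/-- **Registered `h1At_iff_germTight_of_engine`** — given the critical bubble (stmt-7117), the engine (`stub_engine`) and left–right
PA, on an eventually TAME Dobrushin domain (H1) for an endpoint approximation is EQUIVALENT to germ tightness at the two marked
points: ⇐ by the landed tame necklace reduction (`necklaceReduction_tame` p160250) and `stub_eventualShellReduction`, ⇒ by necessity
(`germTight_of_h1At`). [folklore] -/
theorem h1At_iff_germTight_of_engine : CriticalBubbleBound → (LeftRightFKG → CriticalBubbleBound → UniformSubshellTight) →
    LeftRightFKG → ∀ (D : DobrushinDomain) (a b : ℝ → Site 2), IsEndpointApprox D a b → EventuallyTame D →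
      (H1At D a b ↔ (GermTight D a b a ∧ GermTight D a b b)) := by
  intro hB hE hPA D a b hab hD
  refine ⟨germTight_of_h1At D a b hab, fun hG => ?_⟩
  exact stub_eventualShellReduction D a b hab (necklaceReduction_tame (hE hPA hB) D a b hab hD hG.1 hG.2)

/-- The same equivalence with the engine's OUTPUT as the only hypothesis (PA and the bubble enter only through it). [folklore] -/
theorem h1At_iff_germTight_of_uniformSubshellTight (hU : UniformSubshellTight) (D : DobrushinDomain) (a b : ℝ → Site 2)
    (hab : IsEndpointApprox D a b) (hD : EventuallyTame D) :
    H1At D a b ↔ (GermTight D a b a ∧ GermTight D a b b) :=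
  ⟨germTight_of_h1At D a b hab, fun hG =>
    stub_eventualShellReduction D a b hab (necklaceReduction_tame hU D a b hab hD hG.1 hG.2)⟩

/-- **The unit disc.**  Given the bubble, the engine and PA, (H1) for ANY endpoint approximation of the unit disc (the domain of
every deep-fragment certificate: `Negative.exists_isEndpointApprox_not_bdryApprox`, `deepStart_eventually_not_presentable`) is equivalent
to germ tightness at the two marked points — the disc is eventually tame (`eventuallyTame_unitDisc`, p166007). [folklore] -/
theorem h1At_unitDisc_iff_germTight_of_engine (hB : CriticalBubbleBound)
    (hE : LeftRightFKG → CriticalBubbleBound → UniformSubshellTight) (hPA : LeftRightFKG) (a b : ℝ → Site 2)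
    (hab : IsEndpointApprox DobrushinDomain.unitDisc a b) :
    H1At DobrushinDomain.unitDisc a b ↔
      (GermTight DobrushinDomain.unitDisc a b a ∧ GermTight DobrushinDomain.unitDisc a b b) :=
  h1At_iff_germTight_of_engine hB hE hPA DobrushinDomain.unitDisc a b hab eventuallyTame_unitDisc

/-- **The unit disc, shallow approximations**: there (H1) needs only bubble + engine + PA (`germTight_pair_of_shallow`). [folklore] -/
theorem h1At_unitDisc_of_shallow (hB : CriticalBubbleBound)
    (hE : LeftRightFKG → CriticalBubbleBound → UniformSubshellTight) (hPA : LeftRightFKG) (a b : ℝ → Site 2) (K : ℝ)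
    (hab : IsEndpointApprox DobrushinDomain.unitDisc a b)
    (hsh : ∀ᶠ δ in 𝓝[>] (0 : ℝ), infDist (meshPoint δ (a δ)) DobrushinDomain.unitDisc.carrierᶜ ≤ K * δ ∧
      infDist (meshPoint δ (b δ)) DobrushinDomain.unitDisc.carrierᶜ ≤ K * δ) :
    H1At DobrushinDomain.unitDisc a b :=
  (h1At_unitDisc_iff_germTight_of_engine hB hE hPA a b hab).2
    (germTight_pair_of_shallow DobrushinDomain.unitDisc a b K hsh)

end Summit.CriticalPhenomena.SAWScalingLimit.Theorems.FKGToTraversalBound.SlitNecklace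

end
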